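import Literature.NumberTheory.EllipticCurves.DivisionValuesNonsingularReductionProofs
import Literature.NumberTheory.EllipticCurves.DivisionPolynomialFormalMulProofs
import Literature.NumberTheory.EllipticCurves.CanonicalPAdicHeightLeavesProofs
import Literature.NumberTheory.EllipticCurves.CanonicalPAdicHeightThetaProofs
import HarnessLib

/-!
# The global denominator law `den x(nP) = (den x(P))^{n²} · ψₙ(P)²` for a rational point with
# non-singular reduction at every prime (proofs only)

Topic `NumberTheory/EllipticCurves` (trunk T-NT-EC); a proofs-only sequel (theorems only, no
definition, no named fact, net literature debt `0`) of `DivisionValuesNonsingularReductionProofs`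
(Ayad's lemma; the exact denominator `den x(nP) = ψₙ(P)²` of an INTEGRAL point) and of
`LocalDenominatorLawIdentityComponent` (the global law `den x(P+Q)·den x(P−Q) = den² den² (x₁−x₂)²`).

Let `W/ℚ` be a Weierstrass equation with integer coefficients, `P = (x, y) ∈ E(ℚ)` ANY rational
point (integral or not) with non-singular reduction modulo every prime (`HasNonsingularReductionAt`,
automatic at the primes where `P` is not integral), and `n ∈ ℤ` with `nP = (x', y') ≠ O`. Then

  `den x(nP) = (den x(P))^{n²} · ΨSqₙ(x(P)) = (den x(P))^{n²} · ψₙ(P)²`   (exact equality in `ℚ`).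

Writing `x = a/e²` this is the classical statement that the elliptic divisibility sequence of `P`
is `e(nP) = e(P)^{n²}·|ψ̂ₙ(P)|`, `ψ̂ₙ = e^{n²−1}ψₙ(P) ∈ ℤ`, with NO cancellation at any prime as soon
as `P` meets the identity component everywhere (Ward 1948 / Silverman 2005 Prop. 18: "the
denominator of `γ` is divisible only by primes … at which `P mod p` is the singular point"; Ayad
1992; Stange 2016 Lemma 29 `D_n = |W_n|`; Cheon–Hahn 1999). It is the `x`-denominator half of the
quasi-quadraticity of naive heights under multiplication and the input of Step 1 of the
Mazur–Stein–Tate `p`-adic height algorithm for NON-integral points (`h(nP) = n²h(P)` for the sigma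
height, successor file on the Summits side).

## Proof (prime by prime)
At a prime `ℓ`, with `M(x) = max(1, ‖x‖_ℓ)` the LOCAL LAW is `M(x(nP))·‖ΨSqₙ(x)‖_ℓ = M(x)^{n²}`
(`WeierstrassCurve.max_one_norm_zsmul_mul_norm_ΨSq`):
* `‖x‖_ℓ > 1` (`P ∈ E₁(ℚ_ℓ)`): `x(nP)·ΨSqₙ(x) = Φₙ(x)` (`mul_eval_ΨSq_of_zsmul_eq`, AEC Ex. 3.7(d)) with
  `Φₙ` MONIC of degree `n²` and `ΨSqₙ` of degree `≤ n²−1`, both with `ℓ`-integral coefficients, so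
  `‖Φₙ(x)‖ = ‖x‖^{n²}` dominates (`norm_eval_eq_pow_of_coeff_eq_one`) and `‖x(nP)‖ ≥ ‖x‖ > 1`;
* `‖x‖_ℓ ≤ 1`: if `‖ψₙ(P)‖_ℓ < 1` this is Ayad's lemma `norm_φ_div_ψ_sq_eq`
  (`‖x(nP)‖ = ‖ψₙ(P)‖⁻²`); otherwise `‖ψₙ(P)‖ = 1` and `x(nP) = Φₙ(x)/ψₙ²` is `ℓ`-integral.
Reading `M(x) = ℓ^{ord_ℓ den x}` (`max_one_norm_ratCast`) the local laws for all `ℓ` give the identity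
of natural numbers `den x(nP)·den(ΨSqₙ(x)) = (den x)^{n²}·|num(ΨSqₙ(x))|`
(`Nat.eq_iff_prime_padicValNat_eq`), and `ΨSqₙ(x) = ψₙ(P)² > 0`.

## Contents
* `Literature.NumberTheory.EllipticCurves.norm_eval_le_max_pow_of_norm_coeff_le_one`,
  `….norm_eval_eq_pow_of_coeff_eq_one` — ultrametric evaluation bounds for `ℓ`-integral polynomials;
* `WeierstrassCurve.ratCast_eval_Φ`, `….ratCast_eval_ΨSq`, `….norm_ratCast_eval_Φ_le`,
  `….norm_ratCast_eval_Φ_of_one_lt`, `….norm_ratCast_eval_ΨSq_le` — `Φₙ`, `ΨSqₙ` of `W/ℚ` read in `ℚ_ℓ`;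
* `WeierstrassCurve.eval_ΨSq_ne_zero_of_zsmul_eq_some`, `….eval_ΨSq_pos_of_zsmul_eq_some`;
* `WeierstrassCurve.max_one_norm_zsmul_mul_norm_ΨSq` — the local law at `ℓ`;
* `WeierstrassCurve.den_zsmul_eq_den_pow_mul_eval_ΨSq`, `….den_zsmul_eq_den_pow_mul_evalEval_ψ_sq`
  — the global law.

## References
* [Silverman2005DivPoly] J. H. Silverman, *p-adic properties of division polynomials and elliptic
  divisibility sequences*, Math. Ann. 332 (2005), §7 Prop. 18 (held text `paper:arxiv-math-0404412`
  p. 21: `W_n = γ^{n²−1}F_n(P)`, "the denominator of `γ` is divisible only by primes of bad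
  reduction of `P`").
* [Stange2016] K. E. Stange, *Integral points on elliptic curves and explicit valuations of division
  polynomials*, Canad. J. Math. 68 (2016), §10 Lemma 29 (`D_n ∣ W_n`, `v(W_n) = v(D_n)` at primes of
  non-singular reduction).
* [Ayad1992] M. Ayad, *Points S-entiers des courbes elliptiques*, Manuscripta Math. 76 (1992).
* [SilvermanAEC2009] J. H. Silverman, *AEC* 2nd ed., Exercise 3.7(d) (`x(nP) = φₙ/ψₙ²`), VII.2.2.
* [MazurSteinTate2006] B. Mazur, W. Stein, J. Tate, Doc. Math. Extra Vol. (2006), §1 and Alg. 3.4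
  Step 1 (`d(P)` and the multiple `nP`).

## Design
Proofs only; `n : ℤ` throughout (`n.natAbs ^ 2` for `n²` in exponents); the multiple is given as a
hypothesis `n • P = (x', y')` (so `nP ≠ O`, i.e. `ψₙ(P) ≠ 0`, is implied). No minimality is used.
-/

noncomputable section

open scoped Classical
open Polynomial

namespace Literature.NumberTheory.EllipticCurves

/-! ### Ultrametric evaluation of `ℓ`-integral polynomials -/

section PolyNorm

variable {p : ℕ} [Fact p.Prime]

/-- **Evaluation bound.** For `f ∈ ℚ_p[X]` with `p`-integral coefficients and `deg f ≤ d`: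
`‖f(x)‖ ≤ max(1, ‖x‖)^d` (each term `‖fᵢxⁱ‖ ≤ max(1,‖x‖)ⁱ ≤ max(1,‖x‖)^d`, ultrametric inequality).
[cite: Gouvea1993PadicNumbers, §2.3 (strong triangle inequality) and Prop. 3.3.4] -/
theorem norm_eval_le_max_pow_of_norm_coeff_le_one {f : ℚ_[p][X]} (hf : ∀ i, ‖f.coeff i‖ ≤ 1)
    {d : ℕ} (hd : f.natDegree ≤ d) (x : ℚ_[p]) : ‖f.eval x‖ ≤ (max 1 ‖x‖) ^ d := by
  have hM : 1 ≤ max 1 ‖x‖ := le_max_left _ _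
  rw [eval_eq_sum_range' (Nat.lt_succ_of_le hd)]
  refine IsUltrametricDist.norm_sum_le_of_forall_le_of_nonneg (by positivity) fun i hi => ?_
  rw [Finset.mem_range] at hi
  rw [norm_mul, norm_pow]
  calc ‖f.coeff i‖ * ‖x‖ ^ i ≤ 1 * (max 1 ‖x‖) ^ d :=
        mul_le_mul (hf i) ((pow_le_pow_left₀ (norm_nonneg _) (le_max_right _ _) i).trans
          (pow_le_pow_right₀ hM (by omega))) (by positivity) zero_le_one
    _ = (max 1 ‖x‖) ^ d := one_mul _

/-- **Dominance of the leading term.** For `f ∈ ℚ_p[X]` with `p`-integral coefficients,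
`deg f ≤ d` and `[X^d]f = 1` (monic of degree `d`), at `‖x‖ > 1`: `‖f(x)‖ = ‖x‖^d` (the lower terms
have norm `≤ ‖x‖^{d−1} < ‖x‖^d`; "all triangles are isosceles").
[cite: Gouvea1993PadicNumbers, §2.3 Cor. 2.3.4 ("all triangles are isosceles")] -/
theorem norm_eval_eq_pow_of_coeff_eq_one {f : ℚ_[p][X]} (hf : ∀ i, ‖f.coeff i‖ ≤ 1) {d : ℕ}
    (hd : f.natDegree ≤ d) (hlead : f.coeff d = 1) {x : ℚ_[p]} (hx : 1 < ‖x‖) :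
    ‖f.eval x‖ = ‖x‖ ^ d := by
  rw [eval_eq_sum_range' (Nat.lt_succ_of_le hd), Finset.sum_range_succ, hlead, one_mul]
  rcases Nat.eq_zero_or_pos d with rfl | hdpos
  · simp
  have hlt : ‖∑ i ∈ Finset.range d, f.coeff i * x ^ i‖ < ‖x ^ d‖ := by
    have hle : ‖∑ i ∈ Finset.range d, f.coeff i * x ^ i‖ ≤ ‖x‖ ^ (d - 1) := by
      refine IsUltrametricDist.norm_sum_le_of_forall_le_of_nonneg (by positivity) fun i hi => ?_
      rw [Finset.mem_range] at hi
      rw [norm_mul, norm_pow]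
      calc ‖f.coeff i‖ * ‖x‖ ^ i ≤ 1 * ‖x‖ ^ (d - 1) :=
            mul_le_mul (hf i) (pow_le_pow_right₀ hx.le (by omega)) (by positivity) zero_le_one
        _ = ‖x‖ ^ (d - 1) := one_mul _
    refine hle.trans_lt ?_
    rw [norm_pow]
    exact pow_lt_pow_right₀ hx (by omega)
  rw [Padic.add_eq_max_of_ne hlt.ne, max_eq_right hlt.le, norm_pow]

end PolyNorm

end Literature.NumberTheory.EllipticCurves

namespace WeierstrassCurve

open Literature.NumberTheory.EllipticCurves

section NatAbs

variable {R : Type*} [CommRing R] (V : WeierstrassCurve R)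

/-- `Φₙ = Φ_{|n|}` (`Φ₋ₙ = Φₙ`). [cite: SilvermanAEC2009, Exercise 3.7] -/
theorem Φ_natAbs (n : ℤ) : V.Φ (n.natAbs : ℤ) = V.Φ n := by
  rcases Int.natAbs_eq n with h | h
  · rw [← h]
  · rw [h, Φ_neg, Int.natAbs_neg, Int.natAbs_natCast]

/-- `ΨSqₙ = ΨSq_{|n|}` (`ΨSq₋ₙ = ΨSqₙ`). [cite: SilvermanAEC2009, Exercise 3.7] -/
theorem ΨSq_natAbs (n : ℤ) : V.ΨSq (n.natAbs : ℤ) = V.ΨSq n := by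
  rcases Int.natAbs_eq n with h | h
  · rw [← h]
  · rw [h, ΨSq_neg, Int.natAbs_neg, Int.natAbs_natCast]

end NatAbs

variable (W : WeierstrassCurve ℚ) [W.IsIntegral ℤ] (ℓ : ℕ) [Fact ℓ.Prime]

/-! ### `Φₙ`, `ΨSqₙ` of `W/ℚ` read in `ℚ_ℓ` -/

omit [W.IsIntegral ℤ] in
/-- `Φₙ(x)` cast to `ℚ_ℓ` is `Φₙ` of `W ⊗ ℚ_ℓ` at `x` (the division polynomials commute with base
change, Mathlib `map_Φ`). [cite: SilvermanAEC2009, Exercise 3.7(b)] -/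
theorem ratCast_eval_Φ (n : ℤ) (x : ℚ) :
    (((W.Φ n).eval x : ℚ) : ℚ_[ℓ]) = ((W.baseChange ℚ_[ℓ]).Φ n).eval (x : ℚ_[ℓ]) := by
  have h := eval₂_at_apply (p := W.Φ n) (algebraMap ℚ ℚ_[ℓ]) x
  rw [eq_ratCast, eq_ratCast] at h
  rw [← h, baseChange, map_Φ, eval_map]

omit [W.IsIntegral ℤ] in
/-- `ΨSqₙ(x)` cast to `ℚ_ℓ` is `ΨSqₙ` of `W ⊗ ℚ_ℓ` at `x` (Mathlib `map_ΨSq`).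
[cite: SilvermanAEC2009, Exercise 3.7(b)] -/
theorem ratCast_eval_ΨSq (n : ℤ) (x : ℚ) :
    (((W.ΨSq n).eval x : ℚ) : ℚ_[ℓ]) = ((W.baseChange ℚ_[ℓ]).ΨSq n).eval (x : ℚ_[ℓ]) := by
  have h := eval₂_at_apply (p := W.ΨSq n) (algebraMap ℚ ℚ_[ℓ]) x
  rw [eq_ratCast, eq_ratCast] at h
  rw [← h, baseChange, map_ΨSq, eval_map]

/-- The coefficients of `Φₙ` of `W ⊗ ℚ_ℓ` are `ℓ`-integral (`W` has integer coefficients;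
`φₙ ∈ ℤ[a₁,…,a₆,x,y]`). [cite: SilvermanAEC2009, Exercise 3.7(b)] -/
theorem norm_coeff_Φ_baseChange_le_one (n : ℤ) (i : ℕ) :
    ‖((W.baseChange ℚ_[ℓ]).Φ n).coeff i‖ ≤ 1 := by
  rw [← Φ_natAbs]
  exact (W.baseChange ℚ_[ℓ]).norm_coeff_Φ_le_one n.natAbs i

/-- The coefficients of `ΨSqₙ` of `W ⊗ ℚ_ℓ` are `ℓ`-integral (`ψₙ² ∈ ℤ[a₁,…,a₆,x]`).
[cite: SilvermanAEC2009, Exercise 3.7(b)] -/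
theorem norm_coeff_ΨSq_baseChange_le_one (n : ℤ) (i : ℕ) :
    ‖((W.baseChange ℚ_[ℓ]).ΨSq n).coeff i‖ ≤ 1 := by
  rw [← ΨSq_natAbs]
  exact (W.baseChange ℚ_[ℓ]).norm_coeff_ΨSq_le_one n.natAbs i

/-- `‖Φₙ(x)‖_ℓ ≤ max(1, ‖x‖_ℓ)^{n²}`. [cite: SilvermanAEC2009, Exercise 3.7(b)] -/
theorem norm_ratCast_eval_Φ_le (n : ℤ) (x : ℚ) :
    ‖(((W.Φ n).eval x : ℚ) : ℚ_[ℓ])‖ ≤ (max 1 ‖(x : ℚ_[ℓ])‖) ^ (n.natAbs ^ 2) := by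
  rw [ratCast_eval_Φ]
  exact norm_eval_le_max_pow_of_norm_coeff_le_one (W.norm_coeff_Φ_baseChange_le_one ℓ n)
    ((W.baseChange ℚ_[ℓ]).natDegree_Φ_le n) _

/-- **`‖Φₙ(x)‖_ℓ = ‖x‖_ℓ^{n²}` for `‖x‖_ℓ > 1`**: `Φₙ = x^{n²} + ⋯` is monic with integral
coefficients, so the leading term dominates off the integral locus.
[cite: SilvermanAEC2009, Exercise 3.7(b)] -/
theorem norm_ratCast_eval_Φ_of_one_lt (n : ℤ) {x : ℚ} (hx : 1 < ‖(x : ℚ_[ℓ])‖) :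
    ‖(((W.Φ n).eval x : ℚ) : ℚ_[ℓ])‖ = ‖(x : ℚ_[ℓ])‖ ^ (n.natAbs ^ 2) := by
  rw [ratCast_eval_Φ]
  exact norm_eval_eq_pow_of_coeff_eq_one (W.norm_coeff_Φ_baseChange_le_one ℓ n)
    ((W.baseChange ℚ_[ℓ]).natDegree_Φ_le n) ((W.baseChange ℚ_[ℓ]).coeff_Φ n) hx

/-- `‖ΨSqₙ(x)‖_ℓ ≤ max(1, ‖x‖_ℓ)^{n²−1}` (`deg ΨSqₙ ≤ n² − 1`, integral coefficients).
[cite: SilvermanAEC2009, Exercise 3.7(b)] -/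
theorem norm_ratCast_eval_ΨSq_le (n : ℤ) (x : ℚ) :
    ‖(((W.ΨSq n).eval x : ℚ) : ℚ_[ℓ])‖ ≤ (max 1 ‖(x : ℚ_[ℓ])‖) ^ (n.natAbs ^ 2 - 1) := by
  rw [ratCast_eval_ΨSq]
  exact norm_eval_le_max_pow_of_norm_coeff_le_one (W.norm_coeff_ΨSq_baseChange_le_one ℓ n)
    ((W.baseChange ℚ_[ℓ]).natDegree_ΨSq_le n) _

/-! ### The local law at a prime `ℓ` -/

omit [W.IsIntegral ℤ] [Fact ℓ.Prime] in
/-- If `nP = (x', y')` is affine then `ΨSqₙ(x(P)) ≠ 0` (`[n]P = O ↔ ΨSqₙ(x) = 0`).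
[cite: SilvermanAEC2009, Exercise 3.7(f)] -/
theorem eval_ΨSq_ne_zero_of_zsmul_eq_some [W.IsElliptic] {x y : ℚ} (h : W.toAffine.Nonsingular x y)
    {n : ℤ} {x' y' : ℚ} (h' : W.toAffine.Nonsingular x' y')
    (hn : n • (Affine.Point.some x y h : W.toAffine.Point) = .some x' y' h') :
    (W.ΨSq n).eval x ≠ 0 := fun h0 => by
  have e : n • (Affine.Point.some x y h : W.toAffine.Point) = 0 := by
    convert (W.zsmul_some_eq_zero_iff_eval_ΨSq h n).mpr h0
  rw [hn] at e
  cases e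

omit [W.IsIntegral ℤ] [Fact ℓ.Prime] in
/-- If `nP` is affine then `ΨSqₙ(x(P)) = ψₙ(P)² > 0`. [cite: SilvermanAEC2009, Exercise 3.7(f)] -/
theorem eval_ΨSq_pos_of_zsmul_eq_some [W.IsElliptic] {x y : ℚ} (h : W.toAffine.Nonsingular x y)
    {n : ℤ} {x' y' : ℚ} (h' : W.toAffine.Nonsingular x' y')
    (hn : n • (Affine.Point.some x y h : W.toAffine.Point) = .some x' y' h') :
    0 < (W.ΨSq n).eval x := by
  have hne := W.eval_ΨSq_ne_zero_of_zsmul_eq_some h h' hn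
  rw [← W.evalEval_ψ_sq h.left n] at hne ⊢
  exact lt_of_le_of_ne (sq_nonneg _) (Ne.symm hne)

/-- **THE LOCAL LAW at `ℓ`.** `W/ℚ` with integer coefficients, `P = (x, y)` with non-singular
reduction modulo `ℓ`, `nP = (x', y')` affine. Then
`max(1, ‖x'‖_ℓ) · ‖ΨSqₙ(x)‖_ℓ = max(1, ‖x‖_ℓ)^{n²}`, i.e.
`ord_ℓ den x(nP) = n² ord_ℓ den x(P) + ord_ℓ ψₙ(P)²`. Off the integral locus this is the dominance
of the monic `Φₙ` in `x(nP)·ΨSqₙ(x) = Φₙ(x)`; on it, Ayad's lemma (`norm_φ_div_ψ_sq_eq`).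
[cite: Stange2016, §10 Lemma 29] [cite: Ayad1992, Lemme] [cite: SilvermanAEC2009, Exercise 3.7(d)] -/
theorem max_one_norm_zsmul_mul_norm_ΨSq [W.IsElliptic] {x y : ℚ} (h : W.toAffine.Nonsingular x y)
    {n : ℤ} {x' y' : ℚ} (h' : W.toAffine.Nonsingular x' y')
    (hn : n • (Affine.Point.some x y h : W.toAffine.Point) = .some x' y' h')
    (hred : W.HasNonsingularReductionAt ℓ x y) :
    max 1 ‖(x' : ℚ_[ℓ])‖ * ‖(((W.ΨSq n).eval x : ℚ) : ℚ_[ℓ])‖ =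
      (max 1 ‖(x : ℚ_[ℓ])‖) ^ (n.natAbs ^ 2) := by
  have hn0 : n ≠ 0 := by
    rintro rfl
    rw [zero_zsmul] at hn
    cases hn
  have hn1 : 1 ≤ n.natAbs ^ 2 := Nat.one_le_pow _ _ (Int.natAbs_pos.mpr hn0)
  have hΨ := W.eval_ΨSq_ne_zero_of_zsmul_eq_some h h' hn
  have hΨ' : (((W.ΨSq n).eval x : ℚ) : ℚ_[ℓ]) ≠ 0 := by exact_mod_cast hΨ
  have hΨpos : 0 < ‖(((W.ΨSq n).eval x : ℚ) : ℚ_[ℓ])‖ := norm_pos_iff.mpr hΨ'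
  have hmul : x' * (W.ΨSq n).eval x = (W.Φ n).eval x :=
    W.mul_eval_ΨSq_of_zsmul_eq h n h' (by convert hn)
  have hmul' : (x' : ℚ_[ℓ]) * (((W.ΨSq n).eval x : ℚ) : ℚ_[ℓ]) = (((W.Φ n).eval x : ℚ) : ℚ_[ℓ]) := by
    exact_mod_cast hmul
  by_cases hx : 1 < ‖(x : ℚ_[ℓ])‖
  · -- `P ∈ E₁(ℚ_ℓ)`: the monic `Φₙ` dominates
    have hprod : ‖(x' : ℚ_[ℓ])‖ * ‖(((W.ΨSq n).eval x : ℚ) : ℚ_[ℓ])‖ =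
        ‖(x : ℚ_[ℓ])‖ ^ (n.natAbs ^ 2) := by
      rw [← norm_mul, hmul', W.norm_ratCast_eval_Φ_of_one_lt ℓ n hx]
    have hΨle : ‖(((W.ΨSq n).eval x : ℚ) : ℚ_[ℓ])‖ ≤ ‖(x : ℚ_[ℓ])‖ ^ (n.natAbs ^ 2 - 1) := by
      have := W.norm_ratCast_eval_ΨSq_le ℓ n x
      rwa [max_eq_right hx.le] at this
    have hx' : 1 < ‖(x' : ℚ_[ℓ])‖ := by
      by_contra hle
      rw [not_lt] at hle
      have hle' : ‖(x : ℚ_[ℓ])‖ ^ (n.natAbs ^ 2) ≤ ‖(x : ℚ_[ℓ])‖ ^ (n.natAbs ^ 2 - 1) := by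
        rw [← hprod]
        calc ‖(x' : ℚ_[ℓ])‖ * ‖(((W.ΨSq n).eval x : ℚ) : ℚ_[ℓ])‖
            ≤ 1 * ‖(((W.ΨSq n).eval x : ℚ) : ℚ_[ℓ])‖ := mul_le_mul_of_nonneg_right hle (norm_nonneg _)
          _ ≤ ‖(x : ℚ_[ℓ])‖ ^ (n.natAbs ^ 2 - 1) := by rw [one_mul]; exact hΨle
      exact absurd hle' (not_le.mpr (pow_lt_pow_right₀ hx (by omega)))
    rw [max_eq_right hx'.le, max_eq_right hx.le, hprod]
  · -- `P` is `ℓ`-integral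
    rw [not_lt] at hx
    rw [max_eq_left hx, one_pow]
    have hψsq : (((W.ΨSq n).eval x : ℚ) : ℚ_[ℓ]) = (((W.ψ n).evalEval x y : ℚ) : ℚ_[ℓ]) ^ 2 := by
      rw [← W.evalEval_ψ_sq h.left n]
      push_cast
      rfl
    have hΨle : ‖(((W.ΨSq n).eval x : ℚ) : ℚ_[ℓ])‖ ≤ 1 := by
      have := W.norm_ratCast_eval_ΨSq_le ℓ n x
      rwa [max_eq_left hx, one_pow] at this
    by_cases hψ : ‖(((W.ψ n).evalEval x y : ℚ) : ℚ_[ℓ])‖ < 1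
    · -- Ayad's lemma
      have hA := W.norm_φ_div_ψ_sq_eq ℓ h hx hred hn0 hψ
      have hψ0 : (((W.ψ n).evalEval x y : ℚ) : ℚ_[ℓ]) ≠ 0 := fun h0 => hΨ' (by
        rw [hψsq, h0, zero_pow two_ne_zero])
      have hψpos : 0 < ‖(((W.ψ n).evalEval x y : ℚ) : ℚ_[ℓ])‖ := norm_pos_iff.mpr hψ0
      have hx'eq : x' = (W.φ n).evalEval x y / (W.ψ n).evalEval x y ^ 2 := by
        rw [W.evalEval_φ_eq_eval_Φ h.left n, W.evalEval_ψ_sq h.left n, eq_div_iff hΨ, hmul]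
      have hx'norm : ‖(x' : ℚ_[ℓ])‖ = ‖(((W.ψ n).evalEval x y : ℚ) : ℚ_[ℓ])‖⁻¹ ^ 2 := by
        rw [hx'eq]; exact hA
      have hge : 1 ≤ ‖(x' : ℚ_[ℓ])‖ := by
        rw [hx'norm]
        exact one_le_pow₀ ((one_le_inv₀ hψpos).mpr hψ.le)
      rw [max_eq_right hge, hx'norm, hψsq, norm_pow, ← mul_pow, inv_mul_cancel₀ hψpos.ne', one_pow]
    · -- `ψₙ(P)` is an `ℓ`-adic unit: `x(nP)` is `ℓ`-integral
      rw [not_lt] at hψ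
      have hΨone : ‖(((W.ΨSq n).eval x : ℚ) : ℚ_[ℓ])‖ = 1 := by
        refine le_antisymm hΨle ?_
        rw [hψsq, norm_pow]
        exact one_le_pow₀ hψ
      have hx'le : ‖(x' : ℚ_[ℓ])‖ ≤ 1 := by
        have hΦle : ‖(((W.Φ n).eval x : ℚ) : ℚ_[ℓ])‖ ≤ 1 := by
          have := W.norm_ratCast_eval_Φ_le ℓ n x
          rwa [max_eq_left hx, one_pow] at this
        have e : ‖(x' : ℚ_[ℓ])‖ = ‖(((W.Φ n).eval x : ℚ) : ℚ_[ℓ])‖ := by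
          rw [← hmul', norm_mul, hΨone, mul_one]
        rw [e]; exact hΦle
      rw [max_eq_left hx'le, hΨone, mul_one]

/-! ### The global law -/

/-- **THE GLOBAL DENOMINATOR LAW** `den x(nP) = (den x(P))^{n²} · ΨSqₙ(x(P))` (exact equality of
rationals) for `W/ℚ` with integer coefficients, `P = (x, y) ∈ E(ℚ)` with non-singular reduction
modulo EVERY prime, and `nP = (x', y')` affine. The product over all primes of the local law
`max_one_norm_zsmul_mul_norm_ΨSq` (`max(1,‖x‖_ℓ) = ℓ^{ord_ℓ den x}`; a positive rational is determined
by its valuations). [cite: Silverman2005DivPoly, §7 Prop. 18] [cite: Stange2016, §10 Lemma 29]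
[cite: Ayad1992, Lemme] -/
theorem den_zsmul_eq_den_pow_mul_eval_ΨSq [W.IsElliptic] {x y : ℚ} (h : W.toAffine.Nonsingular x y)
    {n : ℤ} {x' y' : ℚ} (h' : W.toAffine.Nonsingular x' y')
    (hn : n • (Affine.Point.some x y h : W.toAffine.Point) = .some x' y' h')
    (hred : ∀ ℓ : ℕ, ℓ.Prime → W.HasNonsingularReductionAt ℓ x y) :
    (x'.den : ℚ) = (x.den : ℚ) ^ (n.natAbs ^ 2) * (W.ΨSq n).eval x := by
  set q : ℚ := (W.ΨSq n).eval x with hq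
  have hq0 : q ≠ 0 := W.eval_ΨSq_ne_zero_of_zsmul_eq_some h h' hn
  have hqpos : 0 < q := W.eval_ΨSq_pos_of_zsmul_eq_some h h' hn
  have hnumabs : q.num.natAbs ≠ 0 := Int.natAbs_ne_zero.mpr (Rat.num_ne_zero.mpr hq0)
  -- the identity of natural numbers, prime by prime
  have hnat : x'.den * q.den = x.den ^ (n.natAbs ^ 2) * q.num.natAbs := by
    refine (Nat.eq_iff_prime_padicValNat_eq _ _ (Nat.mul_ne_zero x'.den_nz q.den_nz)
      (Nat.mul_ne_zero (pow_ne_zero _ x.den_nz) hnumabs)).mpr fun ℓ hℓ => ?_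
    haveI : Fact ℓ.Prime := ⟨hℓ⟩
    have hℓ0 : (ℓ : ℝ) ≠ 0 := by exact_mod_cast hℓ.ne_zero
    have hℓ1 : (1 : ℝ) < ℓ := by exact_mod_cast hℓ.one_lt
    have hloc := W.max_one_norm_zsmul_mul_norm_ΨSq ℓ h h' hn (hred ℓ hℓ)
    rw [max_one_norm_ratCast, max_one_norm_ratCast, norm_ratCast_eq_zpow ℓ hq0, ← zpow_natCast,
      ← zpow_mul, ← zpow_add₀ hℓ0] at hloc
    have hinj := zpow_right_injective₀ (zero_lt_one.trans hℓ1) hℓ1.ne' hloc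
    have hvq : padicValRat ℓ q = (padicValNat ℓ q.num.natAbs : ℤ) - padicValNat ℓ q.den := by
      rw [padicValRat_def, padicValInt]
    rw [hvq] at hinj
    rw [padicValNat.mul x'.den_nz q.den_nz, padicValNat.mul (pow_ne_zero _ x.den_nz) hnumabs,
      padicValNat.pow]
    push_cast at hinj
    have : ((padicValNat ℓ x'.den + padicValNat ℓ q.den : ℕ) : ℤ) =
        ((n.natAbs ^ 2 * padicValNat ℓ x.den + padicValNat ℓ q.num.natAbs : ℕ) : ℤ) := by
      push_cast; linarith
    exact_mod_cast this
  -- back to `ℚ`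
  have hrat : (x'.den : ℚ) * q.den = (x.den : ℚ) ^ (n.natAbs ^ 2) * (q.num.natAbs : ℚ) := by
    exact_mod_cast hnat
  have hnum : ((q.num.natAbs : ℕ) : ℚ) = q.num := by
    rw [← Int.cast_natCast, Int.natAbs_of_nonneg (Rat.num_nonneg.mpr hqpos.le)]
  have hden : (q.den : ℚ) ≠ 0 := Nat.cast_ne_zero.mpr q.den_nz
  calc (x'.den : ℚ) = (x'.den : ℚ) * q.den / q.den := by rw [mul_div_cancel_right₀ _ hden]
    _ = (x.den : ℚ) ^ (n.natAbs ^ 2) * q.num / q.den := by rw [hrat, hnum]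
    _ = (x.den : ℚ) ^ (n.natAbs ^ 2) * q := by rw [mul_div_assoc, Rat.num_div_den]

/-- The same law with `ψₙ(P)²` (`ΨSqₙ(x) = ψₙ(x, y)²` on the curve):
`den x(nP) = (den x(P))^{n²} · ψₙ(P)²`. [cite: Silverman2005DivPoly, §7 Prop. 18]
[cite: Stange2016, §10 Lemma 29] -/
theorem den_zsmul_eq_den_pow_mul_evalEval_ψ_sq [W.IsElliptic] {x y : ℚ}
    (h : W.toAffine.Nonsingular x y) {n : ℤ} {x' y' : ℚ} (h' : W.toAffine.Nonsingular x' y')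
    (hn : n • (Affine.Point.some x y h : W.toAffine.Point) = .some x' y' h')
    (hred : ∀ ℓ : ℕ, ℓ.Prime → W.HasNonsingularReductionAt ℓ x y) :
    (x'.den : ℚ) = (x.den : ℚ) ^ (n.natAbs ^ 2) * (W.ψ n).evalEval x y ^ 2 := by
  rw [W.evalEval_ψ_sq h.left n]
  exact W.den_zsmul_eq_den_pow_mul_eval_ΨSq h h' hn hred

end WeierstrassCurve

end
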